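/-
Origin: expansion seat `literature-prover-pub-hodgecm-cf-hasseminkowski-g4-0`, handover #3 2026-08-18T05:12:09Z (conditional on cone) (`HOME/pub-hodgecm-cf-hasseminkowski-g4/lean/CfHM4/OMeara6319Holds.lean`, md5 79f446f1, 79 lines);
landed by the gen-6 packager in gate run 22 as `HodgeCM/Literature/OMeara6319Holds.lean` (verbatim).
-/
/-
Copyright: pub-hodgecm formalisation cell (harness21, 2026). New file (not vendored).
Origin: CITED-FACT seat (4) `literature-prover-pub-hodgecm-cf-hasseminkowski-g4-0` (unit pub-hodgecm-cf-hasseminkowski-g4),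
2026-08-18; proposed place `HodgeCM/Literature/OMeara6319Holds.lean`.  CONDITIONAL on the packager landing landherr-g4's vendored
harness cone `HodgeCM/Vendored/H21/**` (it imports one module of it).
-/
import Summits.HodgeConjecture.HodgeCM.Literature.HasseMinkowski
import Literature.NumberTheory.QuadraticForms.HilbertSymbolLocalQuinary

/-!
# O'Meara 63:19 holds (HM-1, class P → K): a quadratic space of dimension `≥ 5` over a local field is isotropic

`HodgeCM.Literature.OMeara_63_19` (O'Meara 1963, 63:19 p. 170, typed verbatim in `Literature/HasseMinkowski.lean` for
diagonal forms `⟨c₁,…,cₙ⟩`, `n ≥ 5`, over the completion `F_v` of a number field at a finite place) is PROVED from the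
vendored harness-tree theorem `Literature.NumberTheory.QuadraticForms.exists_quinary_zero` (Serre, *A Course in Arithmetic*,
Ch. IV §2.2 Thm 6 (iv), kernel-proved there from the structure of `F_vˣ/F_vˣ²`): if some `cᵢ = 0` the `i`-th basis vector is
isotropic; otherwise the first five coefficients are non-zero and `exists_quinary_zero` gives a zero supported on them.
Consequence: `HodgeCM.HasseMinkowskiQuinary` (and `Lemma33bLandherr` along the run-14/18 route) depends on the single printed
input `OMeara_66_1` (66:1, the Hasse principle for isotropy).  Not load-bearing for the headline cone (N14 eliminated, run 19).
-/

set_option autoImplicit false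

noncomputable section

open IsDedekindDomain NumberField

namespace HodgeCM.Literature

/-- **O'Meara 63:19 holds.** -/
theorem OMeara_63_19_holds : OMeara_63_19 := by
  intro F _ _ v n hn c
  classical
  by_cases h0 : ∃ i, c i = 0
  · obtain ⟨i, hi⟩ := h0
    refine ⟨Pi.single i 1, ?_, ?_⟩
    · intro h
      have := congrFun h i
      simp at this
    · have : ∀ j, c j * (Pi.single i (1 : v.adicCompletion F) : Fin n → _) j ^ 2 = if j = i then 0 else 0 := by
        intro j
        by_cases hj : j = i
        · subst hj; simp [hi]
        · simp [hj]
      simp [this]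
  · simp only [not_exists] at h0
    let e : Fin 5 → Fin n := Fin.castLE hn
    have he : Function.Injective e := Fin.castLE_injective hn
    obtain ⟨x, hx0, hx⟩ := Literature.NumberTheory.QuadraticForms.exists_quinary_zero F v
      (h0 (e 0)) (h0 (e 1)) (h0 (e 2)) (h0 (e 3)) (h0 (e 4))
    -- extend `x` by zero along `e`
    let y : Fin n → v.adicCompletion F := Function.extend e x 0
    have hy : ∀ k, y (e k) = x k := fun k => he.extend_apply x 0 k
    have hy' : ∀ j, (∀ k, e k ≠ j) → y j = 0 := by
      intro j hj
      simp only [y]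
      rw [Function.extend_apply']
      · rfl
      · rintro ⟨k, rfl⟩; exact hj k rfl
    refine ⟨y, ?_, ?_⟩
    · intro h
      apply hx0
      funext k
      have := congrFun h (e k)
      rw [hy] at this
      exact this
    · -- the sum over `Fin n` reduces to the image of `e`
      have hsub : ∑ j, c j * y j ^ 2 = ∑ j ∈ (Finset.univ : Finset (Fin 5)).image e, c j * y j ^ 2 := by
        symm
        apply Finset.sum_subset (Finset.subset_univ _)
        intro j _ hj
        have : ∀ k, e k ≠ j := by
          intro k hk; apply hj; exact Finset.mem_image.mpr ⟨k, Finset.mem_univ _, hk⟩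
        rw [hy' j this]; ring
      rw [hsub, Finset.sum_image (fun k _ k' _ h => he h)]
      simp only [hy, Fin.sum_univ_five]
      exact hx

end HodgeCM.Literature
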